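import Summits.QuantumFields.YangMills.Theorems.UnitScaleTiltHalvingCombTorusTower
import Summits.QuantumFields.YangMills.Theorems.UnitScaleTiltHalvingCombStepReadings
import Summits.QuantumFields.YangMills.Theorems.UnitScaleTiltProp8ChartDoubleBarAccFrameSize
import Summits.QuantumFields.YangMills.Theorems.UnitScaleTiltHalvingP1FlatCoreDP1Target
import Summits.QuantumFields.YangMills.Theorems.UnitScaleTiltProp7ChartSigmaT3
import Literature.MathematicalPhysics.QuantumFieldTheory.Balaban1983to89.B9Eq335PlaquettesOfRegularCubeZd
import HarnessLib

/-!
# Line H (`BirthV10.stub_halvingStep`, stmt-QuantumFields-19200) — LEMMA B-al-2, COROLLARY ★ (plaquettes of the comb top average), FILE 1∕2 «CORE»: the four-bond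
# conjugation identity, the IN-BLOCK SIZES of the double-bar tower, and the pulled-plaquette transfer through print's (92) frames
# ([Balaban1985Averaging] (89)∕(92)∕(97), (42)∕(43); [Balaban1985Variational] (6), (156))

Cell `ym3-torus` (HUMAN RULING D-0037: YM₃ on T³ is ladder rung R3 — NOT d = 4, NOT infinite volume, NOT a mass gap, NOT the Clay problem), width seat `ym3-torus-px3` gen 5
((B-v) CONCRETE TOWER + COROLLARY pen, ★★OWNER g29 04:11:16Z).  `--supports stmt-QuantumFields-19200 --as helper`; THEOREMS ONLY (0 `def`, 0 `sorry`); count-neutral; nothing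
here claims (B-iv), the (b)-row, (M2′), the stub, the crux or the gap.

WHY.  The θ-row of the (M2′) assembly (✓p694481) needs the plaquettes of the COMB top average `C_k = avgIter L U′ k`, `U′ = pull X̂ 0`, `X̂ = (U^{gJ})♭`, in the currency `ε₁ + O(ε₀²)`
(LOCATE «J2′» (V2): an `ε₀`-linear top datum kills the halving; the socket's `InAk` alone gives only `4ε₀`, ✓`HalvingCombTorusTower.plaqSmall_avgIter_level`).  The `ε₁` lives in the
FIBRE: `U ∈ 𝔅_k(V)` with `PlaqSmall ε₁ V` makes the torus top average `V̄ = ℰp^{(k)}U` `ε₁`-flat (✓`plaqSmall_iter_of_mem_fibre`), `V̄♭ = Ū^{(k)}(U♭)` (✓`unitsField_toUField_iter_eq_emlIterU`),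
and print's (92) with the covariance (11) writes `V̄♭ = (D_k)^{ψ}`, `D_k = dbarIterU k X̂`, `ψ = (gJ ∘ emb^k)⁻¹·ν_k` (✓`emlIterU_eq_gaugeActT_dbarIterU`) — so a plaquette of `D_k` is a
plaquette of `V̄♭` conjugated by `ψ`, i.e. by the ACCUMULATED FRAME `ν_k` at its corner (the `SU(2)` factor is isometric).  The frames are within `t` of `1` by
✓`Prop8ChartDoubleBarAccFrameSize.one_add_norm_accFrames_sub_one_le_exp` fed with the PER-LEVEL in-block sizes `σ_j = δc·p_j + (102∕100)ρ_j` of `D_j` (px15's ✓`twoBlock_readings` on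
a single block: H_j + block-axiality + `p_j`), and B-al-2's comparison `‖D_k(π b)⁻¹C_k(b) − 1‖ ≤ ρ_k` moves the bound to `C_k` through a four-bond conjugation identity.

WHAT IS PROVED (namespace `…Theorems.HalvingCombTorusPlaquettes`):
* §0 algebra in a normed ring with `‖1‖ = 1` (lit ✓`one_add_norm_mul_sub_one_le`): `norm_conj_near_sub_one_le` (conjugation by a unit within `t ≤ ½` of `1` costs a factor `(1+2t)(1+t)`),
  `one_add_norm_plaq_le_of_ratios` (the four-bond identity `c₁c₂c₃⁻¹c₄⁻¹ = K₃⁻¹K₂⁻¹K₁⁻¹·(a₁a₂a₃⁻¹a₄⁻¹)` with `aᵢ = cᵢrᵢ⁻¹`, `Kᵢ` unitary conjugates of the `r`'s).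
* §1 `norm_dbarIterU_inblock_sub_one_le` — IN-BLOCK SIZE of a torus field `D` against a block-axial, `p`-flat, `U1`-valued `ℤᵈ` field `C` with `‖D(π b)⁻¹C(b) − 1‖ ≤ ρ`:
  `‖D(b̂) − 1‖ ≤ δc·p + (102∕100)ρ` on every bond inside a block (`δc = (2dL+1)(d(L−1)+L)`; px15 ✓`twoBlock_readings` ∘ conjugation by `f(ŷ) ∈ U1`).
* §2 `pull_hol_plaq_eq_conj` — `hol (pull D_k 0) x (∂p) = (ψ′x)⁻¹ · hol (pull V̄♭ 0) x (∂p) · ψ′x` (✓`pull_gaugeActT` + lit ✓`hol_gaugeAct_closed`), `norm_hol_pull_iter_plaq_sub_one_le`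
  (`‖hol (pull V̄♭ 0) x (∂p) − 1‖ ≤ ε₁`, lit ✓`h13_unitsField` ∘ ✓`hol_pull`).
* (FILE 2∕2 `…HalvingCombTorusPlaquettes`: ★★★ `plaqSmall_avgIter_of_levels`, the member statement `PlaqSmall (avgIter L U′ (K−n)) lo hi (3ε₁ + 44R)`.)
HONEST SCOPE.  Generic bookkeeping over landed rows; constants crude.  NOT a claim about the stub, the crux, the rung or a mass gap.

References: T. Bałaban, CMP **98** (1985) 17–51 [Balaban1985Averaging] ((8)–(11) p.19, (42)–(43) pp.23–24, (89) p.31, (92) p.31, (97)–(100) p.32, (110) p.34); CMP **102**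
(1985) 277–309 [Balaban1985Variational] ((6) p.278, (156) p.302); CMP **99** (1985) 75–102 [Balaban1985RegularSpaces] ((1.7) p.77, (1.19) p.79).
-/

set_option autoImplicit false

noncomputable section

open scoped BigOperators Matrix.Norms.L2Operator
open NormedSpace

namespace Summit.QuantumFields.YangMills.Theorems.HalvingCombTorusPlaquettesCore

open Literature.MathematicalPhysics.QuantumFieldTheory.Balaban1983to89
open Literature.MathematicalPhysics.QuantumFieldTheory.Balaban1983to89.T3ContinuumYM3Torus
open Literature.MathematicalPhysics.QuantumFieldTheory.Balaban1983to89.T3PrintedRegularMinimiser (regFibrePr)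
open Literature.MathematicalPhysics.QuantumFieldTheory.Balaban1983to89.T3UnitLawDensityEML (ℰp)
open T4Continuum BlockAveraging
open B7Prop1Explicit renaming Site → LSite
open B7Prop1Explicit (e e_apply boxVec axialFn gaugeAct hol plaqWord U1 mem_U1 axialFn_mem norm_units_conj_sub_one_le norm_units_inv_conj_sub_one_le norm_inv_sub_one_le
  hol_gaugeAct_closed disp_plaqWord)
open B7Prop1Local (InBox bondHi PlaqIn hol_plaqWord_eq)
open B9Eq335PlaquettesOfRegularCubeZd (one_add_norm_mul_sub_one_le)
open B7Prop2Explicit (avgIter pdev C0 c2')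
open B7Prop2SpecialUnitary (specialUnitaryUnits specialUnitaryUnits_le_U1)
open B8Ineq132 (InAk)
open B8Eq119TwistedAxial (InAx)
open B8Lemma1NonAbelian (PlaqSmall)
open B10Eq27TorusAxialLog (pull pull_apply transl unitsField toUField gaugeActT gaugeActT_apply holT pull_gaugeActT hol_pull h13_unitsField
  unitsField_mem_unitaryUnits dist1_plaqHol_toUField)
open B8Thm2SetupTorus (toUGauge)
open Node00 (coverAt coverAt_apply coverAt_valLift)
open T3ConstrainedMinimiser (fibre)
open Summit.QuantumFields.YangMills.Theorems.Prop7AxialReprPrint (pull_toUField_mem pdev_pull_lt)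
open Summit.QuantumFields.YangMills.Theorems.Prop8Chart (emlIterU)
open Summit.QuantumFields.YangMills.Theorems.Prop8ChartDoubleBar (vframeU dbarAvgU dbarIterU exists_accFrames_dbarIterU)
open Summit.QuantumFields.YangMills.Theorems.Prop8ChartDoubleBarAccFrameSize (one_add_norm_accFrames_sub_one_le_exp)
open Summit.QuantumFields.YangMills.Theorems.P1FlatCoreDP1Target (plaqSmall_iter_of_mem_fibre unitsField_toUField_iter_eq_emlIterU emlIterU_eq_gaugeActT_dbarIterU)
open Summit.QuantumFields.YangMills.Theorems.HalvingCombStepReadings (twoBlock_readings update_mem_U1 tgt_coverAt)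
open Summit.QuantumFields.YangMills.Theorems.HalvingCombStepGeometry (pairGauge_values)
open Summit.QuantumFields.YangMills.Theorems.HalvingCombTorusTower (transl_zero_eq_coverAt plaqSmall_avgIter_level avgIter_mem_U1 hblk_of_inAx p_level_le)
open Summit.QuantumFields.YangMills.Theorems.Prop7ChartSigmaT3 (unitsField_toUField_gaugeAct)

/-! ## §0 Algebra -/

section Algebra

variable {𝔸 : Type*} [NormedRing 𝔸] [NormOneClass 𝔸]

/-- Conjugating `Q` by a unit `ν` within `t ≤ ½` of `1`: `‖ν⁻¹·Q·ν − 1‖ ≤ (1 + 2t)·(1 + t)·‖Q − 1‖` (`ν⁻¹Qν − 1 = ν⁻¹(Q − 1)ν`, `‖ν⁻¹‖ ≤ 1 + 2t`). [folklore] -/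
theorem norm_conj_near_sub_one_le (ν : 𝔸ˣ) {t : ℝ} (hν : ‖(ν : 𝔸) - 1‖ ≤ t) (ht : t ≤ 1 / 2) (Q : 𝔸) :
    ‖((ν⁻¹ : 𝔸ˣ) : 𝔸) * Q * (ν : 𝔸) - 1‖ ≤ (1 + 2 * t) * (1 + t) * ‖Q - 1‖ := by
  have ht0 : 0 ≤ t := (norm_nonneg _).trans hν
  have hinv : ‖((ν⁻¹ : 𝔸ˣ) : 𝔸) - 1‖ ≤ 2 * t :=
    (B7Prop6Flat.norm_units_inv_sub_one_le ν (hν.trans ht)).trans (by linarith)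
  have hn : ‖(ν : 𝔸)‖ ≤ 1 + t := by
    have := norm_le_norm_add_norm_sub' (ν : 𝔸) 1; rw [norm_one] at this; linarith
  have hni : ‖((ν⁻¹ : 𝔸ˣ) : 𝔸)‖ ≤ 1 + 2 * t := by
    have := norm_le_norm_add_norm_sub' ((ν⁻¹ : 𝔸ˣ) : 𝔸) 1; rw [norm_one] at this; linarith
  have e : ((ν⁻¹ : 𝔸ˣ) : 𝔸) * Q * (ν : 𝔸) - 1 = ((ν⁻¹ : 𝔸ˣ) : 𝔸) * (Q - 1) * (ν : 𝔸) := by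
    rw [mul_sub, sub_mul, mul_one, Units.inv_mul]
  rw [e]
  calc _ ≤ ‖((ν⁻¹ : 𝔸ˣ) : 𝔸)‖ * ‖Q - 1‖ * ‖(ν : 𝔸)‖ := by
        exact (norm_mul_le _ _).trans (mul_le_mul_of_nonneg_right (norm_mul_le _ _) (norm_nonneg _))
    _ ≤ (1 + 2 * t) * ‖Q - 1‖ * (1 + t) := by gcongr
    _ = (1 + 2 * t) * (1 + t) * ‖Q - 1‖ := by ring

/-- **THE FOUR-BOND CONJUGATION IDENTITY.**  For units `cᵢ ∈ U1` and `aᵢ = cᵢ·rᵢ⁻¹` (`rᵢ = aᵢ⁻¹cᵢ` within `ρ ≤ 1∕8` of `1`):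
`1 + ‖c₁c₂c₃⁻¹c₄⁻¹ − 1‖ ≤ (1 + 2ρ)·(1 + 4ρ)·(1 + 2ρ)·(1 + ‖a₁a₂a₃⁻¹a₄⁻¹ − 1‖)` (`c₁, c₂, c₃ ∈ U1`; `c₄` free) — the plaquette of `C` against the plaquette of `D` when `D⁻¹C` is bondwise within `ρ`
(`c₁c₂c₃⁻¹c₄⁻¹ = K₃⁻¹K₂⁻¹K₁⁻¹·a₁a₂a₃⁻¹a₄⁻¹`, `K₁ = c₁r₁⁻¹c₁⁻¹`, `K₂ = (c₁c₂)(r₂⁻¹r₃)(c₁c₂)⁻¹`, `K₃ = (c₁c₂c₃⁻¹)r₄(c₁c₂c₃⁻¹)⁻¹`, unitary conjugates).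
[cite: Balaban1985Averaging, (8)-(9) p.19] -/
theorem one_add_norm_plaq_le_of_ratios {c₁ c₂ c₃ c₄ a₁ a₂ a₃ a₄ : 𝔸ˣ} (h₁ : c₁ ∈ U1 𝔸) (h₂ : c₂ ∈ U1 𝔸) (h₃ : c₃ ∈ U1 𝔸)
    {ρ : ℝ} (hρ : ρ ≤ 1 / 8)
    (hr₁ : ‖((a₁⁻¹ * c₁ : 𝔸ˣ) : 𝔸) - 1‖ ≤ ρ) (hr₂ : ‖((a₂⁻¹ * c₂ : 𝔸ˣ) : 𝔸) - 1‖ ≤ ρ) (hr₃ : ‖((a₃⁻¹ * c₃ : 𝔸ˣ) : 𝔸) - 1‖ ≤ ρ)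
    (hr₄ : ‖((a₄⁻¹ * c₄ : 𝔸ˣ) : 𝔸) - 1‖ ≤ ρ) :
    1 + ‖((c₁ * c₂ * c₃⁻¹ * c₄⁻¹ : 𝔸ˣ) : 𝔸) - 1‖ ≤
      (1 + 2 * ρ) * (1 + 4 * ρ) * (1 + 2 * ρ) * (1 + ‖((a₁ * a₂ * a₃⁻¹ * a₄⁻¹ : 𝔸ˣ) : 𝔸) - 1‖) := by
  have hρ0 : 0 ≤ ρ := (norm_nonneg _).trans hr₁
  set r₁ : 𝔸ˣ := a₁⁻¹ * c₁ with hr₁d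
  set r₂ : 𝔸ˣ := a₂⁻¹ * c₂ with hr₂d
  set r₃ : 𝔸ˣ := a₃⁻¹ * c₃ with hr₃d
  set r₄ : 𝔸ˣ := a₄⁻¹ * c₄ with hr₄d
  have ha₁ : a₁ = c₁ * r₁⁻¹ := by rw [hr₁d]; group
  have ha₂ : a₂ = c₂ * r₂⁻¹ := by rw [hr₂d]; group
  have ha₃ : a₃ = c₃ * r₃⁻¹ := by rw [hr₃d]; group
  have ha₄ : a₄ = c₄ * r₄⁻¹ := by rw [hr₄d]; group
  -- the three unitary conjugates
  set K₁ : 𝔸ˣ := c₁ * r₁⁻¹ * c₁⁻¹ with hK₁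
  set K₂ : 𝔸ˣ := (c₁ * c₂) * (r₂⁻¹ * r₃) * (c₁ * c₂)⁻¹ with hK₂
  set K₃ : 𝔸ˣ := (c₁ * c₂ * c₃⁻¹) * r₄ * (c₁ * c₂ * c₃⁻¹)⁻¹ with hK₃
  have hid : c₁ * c₂ * c₃⁻¹ * c₄⁻¹ = K₃⁻¹ * K₂⁻¹ * K₁⁻¹ * (a₁ * a₂ * a₃⁻¹ * a₄⁻¹) := by
    rw [ha₁, ha₂, ha₃, ha₄, hK₁, hK₂, hK₃]; group
  -- sizes of the `r`'s and their inverses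
  have hρ2 : ρ ≤ 1 / 2 := by linarith
  -- conjugation by `U1` elements is isometric on `· − 1`
  have hc12 : c₁ * c₂ ∈ U1 𝔸 := (U1 𝔸).mul_mem h₁ h₂
  have hc123 : c₁ * c₂ * c₃⁻¹ ∈ U1 𝔸 := (U1 𝔸).mul_mem hc12 ((U1 𝔸).inv_mem h₃)
  -- `K₁⁻¹ = c₁ r₁ c₁⁻¹`
  have hK₁i : ‖((K₁⁻¹ : 𝔸ˣ) : 𝔸) - 1‖ ≤ ρ := by
    have e1 : K₁⁻¹ = c₁ * r₁ * c₁⁻¹ := by rw [hK₁]; group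
    rw [e1, Units.val_mul, Units.val_mul]
    exact (norm_units_conj_sub_one_le h₁ _).trans hr₁
  -- `K₂⁻¹ = (c₁c₂)(r₃⁻¹ r₂)(c₁c₂)⁻¹`
  have hK₂i : ‖((K₂⁻¹ : 𝔸ˣ) : 𝔸) - 1‖ ≤ 4 * ρ := by
    have e2 : K₂⁻¹ = (c₁ * c₂) * (r₃⁻¹ * r₂) * (c₁ * c₂)⁻¹ := by rw [hK₂]; group
    rw [e2, Units.val_mul, Units.val_mul]
    refine (norm_units_conj_sub_one_le hc12 _).trans ?_
    have hi₃ : ‖((r₃⁻¹ : 𝔸ˣ) : 𝔸) - 1‖ ≤ 2 * ρ := (B7Prop6Flat.norm_units_inv_sub_one_le r₃ (hr₃.trans hρ2)).trans (by linarith)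
    have h := one_add_norm_mul_sub_one_le ((r₃⁻¹ : 𝔸ˣ) : 𝔸) (r₂ : 𝔸)
    rw [Units.val_mul]
    nlinarith [norm_nonneg (((r₃⁻¹ : 𝔸ˣ) : 𝔸) - 1), norm_nonneg ((r₂ : 𝔸) - 1),
      mul_le_mul hi₃ hr₂ (norm_nonneg _) (by linarith)]
  -- `K₃⁻¹ = (c₁c₂c₃⁻¹) r₄⁻¹ (c₁c₂c₃⁻¹)⁻¹`
  have hK₃i : ‖((K₃⁻¹ : 𝔸ˣ) : 𝔸) - 1‖ ≤ 2 * ρ := by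
    have e3 : K₃⁻¹ = (c₁ * c₂ * c₃⁻¹) * r₄⁻¹ * (c₁ * c₂ * c₃⁻¹)⁻¹ := by rw [hK₃]; group
    rw [e3, Units.val_mul, Units.val_mul]
    exact (norm_units_conj_sub_one_le hc123 _).trans ((B7Prop6Flat.norm_units_inv_sub_one_le r₄ (hr₄.trans hρ2)).trans (by linarith))
  -- assemble
  have hval : ((c₁ * c₂ * c₃⁻¹ * c₄⁻¹ : 𝔸ˣ) : 𝔸) =
      ((K₃⁻¹ : 𝔸ˣ) : 𝔸) * ((K₂⁻¹ : 𝔸ˣ) : 𝔸) * ((K₁⁻¹ : 𝔸ˣ) : 𝔸) * ((a₁ * a₂ * a₃⁻¹ * a₄⁻¹ : 𝔸ˣ) : 𝔸) := by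
    rw [hid]; simp only [Units.val_mul]
  rw [hval]
  have s3 := one_add_norm_mul_sub_one_le ((K₃⁻¹ : 𝔸ˣ) : 𝔸) ((K₂⁻¹ : 𝔸ˣ) : 𝔸)
  have s2 := one_add_norm_mul_sub_one_le (((K₃⁻¹ : 𝔸ˣ) : 𝔸) * ((K₂⁻¹ : 𝔸ˣ) : 𝔸)) ((K₁⁻¹ : 𝔸ˣ) : 𝔸)
  have s1 := one_add_norm_mul_sub_one_le (((K₃⁻¹ : 𝔸ˣ) : 𝔸) * ((K₂⁻¹ : 𝔸ˣ) : 𝔸) * ((K₁⁻¹ : 𝔸ˣ) : 𝔸)) ((a₁ * a₂ * a₃⁻¹ * a₄⁻¹ : 𝔸ˣ) : 𝔸)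
  have b32 : 1 + ‖((K₃⁻¹ : 𝔸ˣ) : 𝔸) * ((K₂⁻¹ : 𝔸ˣ) : 𝔸) - 1‖ ≤ (1 + 2 * ρ) * (1 + 4 * ρ) :=
    s3.trans (mul_le_mul (by linarith) (by linarith) (by positivity) (by positivity))
  have b321 : 1 + ‖((K₃⁻¹ : 𝔸ˣ) : 𝔸) * ((K₂⁻¹ : 𝔸ˣ) : 𝔸) * ((K₁⁻¹ : 𝔸ˣ) : 𝔸) - 1‖ ≤ (1 + 2 * ρ) * (1 + 4 * ρ) * (1 + 2 * ρ) :=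
    s2.trans (mul_le_mul b32 (by linarith) (by positivity) (by positivity))
  exact s1.trans (mul_le_mul_of_nonneg_right b321 (by positivity))

end Algebra

/-! ## §1 In-block sizes of the torus field from the comparison with a block-axial `ℤᵈ` field -/

section InBlock

variable {P : Params} {j : ℕ}
variable {𝔸 : Type*} [NormedRing 𝔸] [NormOneClass 𝔸]

/-- ★ **IN-BLOCK SIZE OF THE DOUBLE-BAR FIELD.**  Let `C` be a `U1`-valued `ℤᵈ` field, block-axial on every block with plaquettes `≤ p` on every box, and `D` a torus
field with the comparison `‖D(π_j b)⁻¹·C(b) − 1‖ ≤ ρ` at every `ℤᵈ` bond; `δc·p, ρ ≤ 1∕200` (`δc = (2dL+1)(d(L−1)+L)`).  Then every torus bond `b̂` INSIDE a block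
(`blockOf b̂₋ = blockOf b̂₊`) has `‖D(b̂) − 1‖ ≤ δc·p + (102∕100)·ρ` — px15's ✓`twoBlock_readings` for the pair gauge of the block of `b̂` and any direction, conjugated back by the
(single) value `f(ŷ) ∈ U1` of the block-constant gauge at the two ends. [cite: Balaban1985Averaging, (8) p.19, (11) p.19, p.24; Balaban1987RG1, (0.1)-(0.3) pp.251-252] -/
theorem norm_dbarIterU_inblock_sub_one_le (hj2 : j + 2 ≤ P.m + P.K) (hd : 0 < P.d) (C : LSite P.d → Fin P.d → 𝔸ˣ) (hCU : ∀ x μ, C x μ ∈ U1 𝔸)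
    (D : GaugeField P j 𝔸ˣ) {p ρ : ℝ} (hp : 0 ≤ p)
    (hblk : ∀ (w : LSite P.d) (r : Fin P.d → Fin P.L), axialFn C ((P.L : ℤ) • w) ((P.L : ℤ) • w + boxVec P.L r) = 1)
    (hP : ∀ lo hi : LSite P.d, PlaqSmall C lo hi p)
    (hH : ∀ (x : LSite P.d) (μ : Fin P.d), ‖(((D ⟨coverAt P j x, μ⟩)⁻¹ * C x μ : 𝔸ˣ) : 𝔸) - 1‖ ≤ ρ)
    (hδw : (((2 * (P.d * P.L) + 1) * (P.d * (P.L - 1) + P.L) : ℕ) : ℝ) * p ≤ 1 / 200) (hρw : ρ ≤ 1 / 200)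
    (y : Site P (j + 1)) (b : PBond P j) (hs : blockOf b.src = y) (ht : blockOf b.tgt = y) :
    ‖((D b : 𝔸ˣ) : 𝔸) - 1‖ ≤ (((2 * (P.d * P.L) + 1) * (P.d * (P.L - 1) + P.L) : ℕ) : ℝ) * p + 102 / 100 * ρ := by
  classical
  -- the block as `π_{j+1} z`, a direction `κ`, the pair gauge `f = 1[ĉ₊ ↦ g]`
  set z : LSite P.d := fun μ => ((y μ).val : ℤ) with hz
  have hyz : coverAt P (j + 1) z = y := coverAt_valLift (j + 1) y
  set κ : Fin P.d := ⟨0, hd⟩ with hκ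
  set g : 𝔸ˣ := axialFn C ((P.L : ℤ) • z) ((P.L : ℤ) • (z + e κ)) with hg
  have hgU : g ∈ U1 𝔸 := axialFn_mem hCU _ _
  set f : Site P (j + 1) → 𝔸ˣ := Function.update (fun _ => (1 : 𝔸ˣ)) ((⟨coverAt P (j + 1) z, κ⟩ : PBond P (j + 1)).tgt) g with hf
  have hfU : ∀ w, f w ∈ U1 𝔸 := update_mem_U1 _ hgU
  obtain ⟨-, -, hf0, hf1⟩ := pairGauge_values hj2 (1 : 𝔸ˣ) g z κ
  have hf1' : f (coverAt P (j + 1) (z + e κ)) = g := by rw [hf, ← tgt_coverAt]; exact hf1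
  have hR := (twoBlock_readings hj2 C hCU D f hfU z κ hf0 hf1' hp (hP _ _) hblk hH hδw hρw b
    (Or.inl (hs.trans hyz.symm)) (Or.inl (ht.trans hyz.symm))).2.2
  -- conjugate back: `W(b̂) = f(ŷ)·D(b̂)·f(ŷ)⁻¹`
  have hWb : gaugeActT (fun y' : Site P j => f (blockOf y')) D b = f y * D b * (f y)⁻¹ := by
    rw [gaugeActT_apply, hs, ht]
  rw [hWb] at hR
  have e1 : ((D b : 𝔸ˣ) : 𝔸) = (((f y)⁻¹ : 𝔸ˣ) : 𝔸) * (((f y * D b * (f y)⁻¹ : 𝔸ˣ)) : 𝔸) * ((f y : 𝔸ˣ) : 𝔸) := by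
    rw [← Units.val_mul, ← Units.val_mul]; congr 1; group
  rw [e1]
  exact (norm_units_inv_conj_sub_one_le (hfU y) _).trans hR

end InBlock

/-! ## §2 The pulled plaquettes of the double-bar top field are conjugated plaquettes of the fibre's coarse field -/

section Transfer

variable {P : Params}

/-- **PULLED PLAQUETTES UNDER A TORUS GAUGE COPY**: if `E = D^{ψ}` on the torus (`E(b̂) = ψ(b̂₋)D(b̂)ψ(b̂₊)⁻¹`), then for the based pullbacks at `0`,
`hol (pull D 0) x (∂p_{κμ}) = ψ(π x)⁻¹ · hol (pull E 0) x (∂p_{κμ}) · ψ(π x)` (✓`pull_gaugeActT`, lit ✓`hol_gaugeAct_closed`, `disp ∂p = 0`).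
[cite: Balaban1985Averaging, (8) p.19] -/
theorem hol_pull_plaq_eq_conj {k : ℕ} {G : Type*} [Group G] (D : GaugeField P k G) (ψ : GaugeTransf P k G) (x : LSite P.d) (κ μ : Fin P.d) :
    hol (pull D 0) x (plaqWord κ μ) = (ψ (transl 0 x))⁻¹ * hol (pull (gaugeActT ψ D) 0) x (plaqWord κ μ) * ψ (transl 0 x) := by
  rw [pull_gaugeActT, hol_gaugeAct_closed _ _ x _ (disp_plaqWord κ μ)]
  group

/-- **THE FIBRE's COARSE FIELD IS `ε₁`-FLAT ON THE PULLBACK**: for a torus `SU(N)` field `W` all of whose plaquettes are within `ε₁` (`Setup.PlaqSmall`, strict), the based pullback of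
`W♭ = unitsField (toUField W)` has `‖hol (pull W♭ 0) x (∂p_{κμ}) − 1‖ ≤ ε₁` for `κ ≠ μ` (lit ✓`hol_pull` ∘ ✓`h13_unitsField`, both orientations).
[cite: Balaban1985UV3, (13) p.259; Balaban1985Averaging, (9) p.19] -/
theorem norm_hol_pull_sub_one_le_of_plaqSmall {k N : ℕ} [NeZero N] (W : GaugeField P k (Matrix.specialUnitaryGroup (Fin N) ℂ)) {ε₁ : ℝ}
    (hW : PlaqSmall ε₁ W) (x : LSite P.d) (κ μ : Fin P.d) (hκμ : κ ≠ μ) :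
    ‖((hol (pull (unitsField (toUField W)) 0) x (plaqWord κ μ) : (Matrix (Fin N) (Fin N) ℂ)ˣ) : Matrix (Fin N) (Fin N) ℂ) - 1‖ ≤ ε₁ := by
  rw [hol_pull]
  refine h13_unitsField (lo := x) (hi := x + e κ + e μ) (toUField W) 0 (fun z κ' μ' hlt _ => ?_) x κ μ hκμ ⟨fun i => ⟨le_rfl, ?_⟩, fun i => ⟨?_, le_rfl⟩⟩
  · rw [dist1_plaqHol_toUField]; exact (hW _).le
  · simp only [Pi.add_apply, e_apply]; split_ifs <;> linarith
  · simp only [Pi.add_apply, e_apply]; split_ifs <;> linarith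

end Transfer


end Summit.QuantumFields.YangMills.Theorems.HalvingCombTorusPlaquettesCore

end
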